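import Mathlib
import HarnessLib
import Literature.Analysis.FluidPDE.SpaceTimeCalculus
import Literature.Analysis.FluidPDE.WeakSolution
import Summits.NavierStokesRegularity.NavierStokesRegularity.Theorems.ChiralWindowDoorDefs
import Summits.NavierStokesRegularity.NavierStokesRegularity.Theorems.CriticalFluxDoorDefs
import Summits.NavierStokesRegularity.NavierStokesRegularity.Theorems.RellichScarDefs
import Summits.NavierStokesRegularity.NavierStokesRegularity.Theorems.RellichScarScarRigidityApexRegularityExchange
import Summits.NavierStokesRegularity.NavierStokesRegularity.Theorems.ChiralWindowDoorLambda
import Summits.NavierStokesRegularity.NavierStokesRegularity.Theorems.CriticalFluxDoorLambdaDeriv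

/-!
# Door S21-C «CriticalFluxDoor» — the TIME DERIVATIVE of a door-class profile: smoothness, scale-invariant bounds of all
# spatial orders, and `∂ₜ(Λv) = Λ(∂ₜv)` (F3 plumbing)

Door S21-C of nsreg-p1's local Type-I door family (`HOME/ns-regularity-ideate-p1/ROUND-20.md`; DESIGN-ONLY, route NOT born).
The windowed critical-energy budget F3 (F3-DERIVATION §1) differentiates `Q(a, v(t)) = ∫ a⟪v, Λv⟫` in time; the `Λ`-term
needs `d/dt Λ(v(t))(x) = Λ(∂ₜv(t))(x)`, i.e. differentiation under the kernel integral, dominated through bounds on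
`∂ₜv` and its SECOND SPATIAL DERIVATIVES, locally uniformly in `t`.  For a classical unit-viscosity solution `(v, q)` on
the open backward time axis with the tree's scale-invariant bound package `ScaleInvariantBounds v q`
(`…RellichScarDefs`: all spatial orders of `v`, `q` AND `‖∂ₜ∇ⁿv‖ ≤ L/(‖x‖+√(−t))^{3+n}` in the form
`deriv (s ↦ Dⁿ(v s)(x))`), the exchange `∂ₜDⁿ = Dⁿ∂ₜ` of the tree
(`…RellichScarScarRigidity.deriv_iteratedFDeriv_slice`, crux `ScarRigidity`'s apex-regularity file) turns the third
member of the package into bounds on `Dⁿ(∂ₜv)` (`∂ₜv = timeDeriv v`, the tree's two-sided time derivative):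

* `hasDerivAt_timeLine`, `isSmoothSpaceTimeOn_timeDeriv`, `contDiff_timeDeriv`, `continuousOn_timeDeriv`;
* `norm_iteratedFDeriv_timeDeriv_le` — **`‖Dⁿₓ∂ₜv(t,x)‖ ≤ Lₙ/(‖x‖+√(−t))^{3+n}`**; `exists_timeDeriv_bound(_zero)`;
* `hasDerivAt_fracLapHalf_timeLine` — **`d/dt Λ(v(t))(x) = Λ(∂ₜv(t))(x)`** for `t < 0`
  (Mathlib `hasDerivAt_integral_of_dominated_loc_of_deriv_le` with the `x`-uniform majorant `derivDom` of
  `…CriticalFluxDoorDefs` on the time-neighbourhood `(2t, t/2)`).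

Seat nsreg-p6 g13 (THEOREMS-ONLY door sequels, DIRECTOR-NS g8 #32 (2)/#36).  WHAT THIS IS NOT: not NS regularity (Clay A);
calculus of classical solutions; no route is opened.
-/

noncomputable section

-- the summit and its single sub-problem share the name (CONVENTIONS §1), as in every Theorems file
set_option linter.dupNamespace false

namespace Summit.NavierStokesRegularity.NavierStokesRegularity.Theorems.CriticalFluxDoorTimeDeriv

open MeasureTheory Metric Set Filter Topology Function
open scoped RealInnerProductSpace
open Literature.Analysis Literature.Analysis.FluidPDE
open Summit.NavierStokesRegularity.NavierStokesRegularity.Theorems.ChiralWindowDoorDefs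
open Summit.NavierStokesRegularity.NavierStokesRegularity.Theorems.CriticalFluxDoorDefs
open Summit.NavierStokesRegularity.NavierStokesRegularity.Theorems.RellichScarScarRigidity
  (ScaleInvariantBounds deriv_iteratedFDeriv_slice)
open Summit.NavierStokesRegularity.NavierStokesRegularity.Theorems.ChiralWindowDoorLambda
  (integrable_fracLapHalf_integrand_of_contDiff)
open Summit.NavierStokesRegularity.NavierStokesRegularity.Theorems.CriticalFluxDoorLambdaDeriv
  (integrable_derivDom norm_integrand_le_derivDom)

variable {v : ℝ → EuclideanSpace ℝ (Fin 3) → EuclideanSpace ℝ (Fin 3)} {q : ℝ → EuclideanSpace ℝ (Fin 3) → ℝ}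

/-! ### The time derivative of a classical solution on the open backward axis -/

/-- On the open axis the time line `s ↦ v s x` has derivative `timeDeriv v t x` (`= deriv (s ↦ v s x) t`). -/
theorem hasDerivAt_timeLine (hsol : IsClassicalNSSolutionOn (Iio (0 : ℝ)) 1 0 v q) {t : ℝ} (ht : t < 0)
    (x : EuclideanSpace ℝ (Fin 3)) :
    HasDerivAt (fun s => v s x) (timeDeriv v t x) t :=
  hsol.smooth_velocity.hasDerivAt_timeLine isOpen_Iio ht x

/-- `(t,x) ↦ ∂ₜv(t,x)` is jointly smooth on the open backward slab. -/
theorem isSmoothSpaceTimeOn_timeDeriv (hsol : IsClassicalNSSolutionOn (Iio (0 : ℝ)) 1 0 v q) :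
    IsSmoothSpaceTimeOn (Iio (0 : ℝ)) (timeDeriv v) :=
  hsol.smooth_velocity.isSmoothSpaceTimeOn_deriv isOpen_Iio

/-- The slice `x ↦ ∂ₜv(t,x)` is smooth. -/
theorem contDiff_timeDeriv (hsol : IsClassicalNSSolutionOn (Iio (0 : ℝ)) 1 0 v q) {t : ℝ} (ht : t < 0) (n : ℕ) :
    ContDiff ℝ n (timeDeriv v t) :=
  ((isSmoothSpaceTimeOn_timeDeriv hsol).contDiff_slice ht).of_le (by exact_mod_cast le_top)

/-- Joint continuity of `(t,x) ↦ ∂ₜv(t,x)` on the open backward slab. -/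
theorem continuousOn_timeDeriv (hsol : IsClassicalNSSolutionOn (Iio (0 : ℝ)) 1 0 v q) :
    ContinuousOn (uncurry (timeDeriv v)) (Iio (0 : ℝ) ×ˢ univ) :=
  (isSmoothSpaceTimeOn_timeDeriv hsol).continuousOn

/-- **Scale-invariant bounds for the spatial derivatives of `∂ₜv`**: the third member of the scale-invariant package,
read through the exchange `∂ₜDⁿ = Dⁿ∂ₜ`: `‖Dⁿₓ ∂ₜv(t,x)‖ ≤ L/(‖x‖+√(−t))^{3+n}`. -/
theorem norm_iteratedFDeriv_timeDeriv_le (hsol : IsClassicalNSSolutionOn (Iio (0 : ℝ)) 1 0 v q) {n : ℕ} {L : ℝ}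
    (hL : ∀ t < (0 : ℝ), ∀ x : EuclideanSpace ℝ (Fin 3),
      ‖deriv (fun s => iteratedFDeriv ℝ n (v s) x) t‖ ≤ L / (‖x‖ + Real.sqrt (-t)) ^ (3 + n))
    {t : ℝ} (ht : t < 0) (x : EuclideanSpace ℝ (Fin 3)) :
    ‖iteratedFDeriv ℝ n (timeDeriv v t) x‖ ≤ L / (‖x‖ + Real.sqrt (-t)) ^ (3 + n) := by
  have h : timeDeriv v t = fun y => deriv (fun s => v s y) t := rfl
  rw [h, ← deriv_iteratedFDeriv_slice hsol.smooth_velocity isOpen_Iio n ht x]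
  exact hL t ht x

/-- All-orders form: from `ScaleInvariantBounds v q`, every `n` has `W` with `‖Dⁿₓ∂ₜv(t,x)‖ ≤ W/(‖x‖+√(−t))^{3+n}`. -/
theorem exists_timeDeriv_bound (hsol : IsClassicalNSSolutionOn (Iio (0 : ℝ)) 1 0 v q) (hSIB : ScaleInvariantBounds v q)
    (n : ℕ) :
    ∃ W : ℝ, ∀ t < (0 : ℝ), ∀ x : EuclideanSpace ℝ (Fin 3),
      ‖iteratedFDeriv ℝ n (timeDeriv v t) x‖ ≤ W / (‖x‖ + Real.sqrt (-t)) ^ (3 + n) := by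
  obtain ⟨L, hL⟩ := hSIB n
  exact ⟨L, fun t ht x => norm_iteratedFDeriv_timeDeriv_le hsol (fun s hs y => (hL s hs y).2.2) ht x⟩

/-- Order zero: `‖∂ₜv(t,x)‖ ≤ W/(‖x‖+√(−t))³` with `W ≥ 0`. -/
theorem exists_timeDeriv_bound_zero (hsol : IsClassicalNSSolutionOn (Iio (0 : ℝ)) 1 0 v q)
    (hSIB : ScaleInvariantBounds v q) :
    ∃ W : ℝ, 0 ≤ W ∧ ∀ t < (0 : ℝ), ∀ x : EuclideanSpace ℝ (Fin 3),
      ‖timeDeriv v t x‖ ≤ W / (‖x‖ + Real.sqrt (-t)) ^ 3 := by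
  obtain ⟨W, hW⟩ := exists_timeDeriv_bound hsol hSIB 0
  have hW' : ∀ t < (0 : ℝ), ∀ x : EuclideanSpace ℝ (Fin 3), ‖timeDeriv v t x‖ ≤ W / (‖x‖ + Real.sqrt (-t)) ^ 3 := by
    intro t ht x
    have h := hW t ht x
    rwa [norm_iteratedFDeriv_zero, add_zero] at h
  have hW0 : 0 ≤ W := by
    have h := hW' (-1) (by norm_num) 0
    have hpos : 0 < (‖(0 : EuclideanSpace ℝ (Fin 3))‖ + Real.sqrt (-(-1 : ℝ))) ^ 3 := by
      rw [norm_zero, zero_add]; exact pow_pos (Real.sqrt_pos.2 (by norm_num)) _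
    by_contra hneg
    push Not at hneg
    have : W / (‖(0 : EuclideanSpace ℝ (Fin 3))‖ + Real.sqrt (-(-1 : ℝ))) ^ 3 < 0 := div_neg_of_neg_of_pos hneg hpos
    linarith [norm_nonneg (timeDeriv v (-1) 0)]
  exact ⟨W, hW0, hW'⟩

/-! ### `∂ₜ(Λv) = Λ(∂ₜv)` -/

/-- A scale-invariant bound `L/(‖y‖+√(−s))^k` is uniform on the time-neighbourhood `(2t, t/2)` of `t < 0`:
`≤ |L|/√(−t/2)^k` there. -/
theorem unif_of_scaleInvariant {g : ℝ → EuclideanSpace ℝ (Fin 3) → ℝ} {L : ℝ} {k : ℕ} {t : ℝ} (ht : t < 0)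
    (h : ∀ s < (0 : ℝ), ∀ y : EuclideanSpace ℝ (Fin 3), g s y ≤ L / (‖y‖ + Real.sqrt (-s)) ^ k)
    {s : ℝ} (hs : s ∈ Ioo (2 * t) (t / 2)) (y : EuclideanSpace ℝ (Fin 3)) :
    g s y ≤ |L| / Real.sqrt (-(t / 2)) ^ k := by
  have hs0 : s < 0 := by linarith [hs.2]
  have ha0 : 0 < Real.sqrt (-(t / 2)) := Real.sqrt_pos.2 (by linarith)
  have hsqrt : Real.sqrt (-(t / 2)) ≤ Real.sqrt (-s) := Real.sqrt_le_sqrt (by linarith [hs.2])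
  have hden : Real.sqrt (-(t / 2)) ^ k ≤ (‖y‖ + Real.sqrt (-s)) ^ k :=
    pow_le_pow_left₀ ha0.le (by linarith [norm_nonneg y]) k
  calc g s y ≤ L / (‖y‖ + Real.sqrt (-s)) ^ k := h s hs0 y
    _ ≤ |L| / (‖y‖ + Real.sqrt (-s)) ^ k := div_le_div_of_nonneg_right (le_abs_self L) (by positivity)
    _ ≤ |L| / Real.sqrt (-(t / 2)) ^ k := div_le_div_of_nonneg_left (abs_nonneg L) (by positivity) hden

/-- **`d/dt Λ(v(t))(x) = Λ(∂ₜv(t))(x)` on `t < 0`** for a classical unit-viscosity solution with the scale-invariant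
package: differentiation under the kernel integral, dominated on the time-neighbourhood `(2t, t/2)` by the `x`-uniform
majorant `derivDom M₁ M₃` built from the sup bounds of `∂ₜv` and `D²ₓ∂ₜv` there. -/
theorem hasDerivAt_fracLapHalf_timeLine (hsol : IsClassicalNSSolutionOn (Iio (0 : ℝ)) 1 0 v q)
    (hSIB : ScaleInvariantBounds v q) {t : ℝ} (ht : t < 0) (x : EuclideanSpace ℝ (Fin 3)) :
    HasDerivAt (fun s => fracLapHalf (v s) x) (fracLapHalf (timeDeriv v t) x) t := by
  obtain ⟨W₀, hW₀⟩ := exists_timeDeriv_bound hsol hSIB 0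
  obtain ⟨W₂, hW₂⟩ := exists_timeDeriv_bound hsol hSIB 2
  obtain ⟨L₀, hL₀⟩ := hSIB 0
  obtain ⟨L₂, hL₂⟩ := hSIB 2
  -- the time neighbourhood `(2t, t/2)` and the uniform constants there
  set a : ℝ := Real.sqrt (-(t / 2)) with ha
  have hI : Ioo (2 * t) (t / 2) ∈ 𝓝 t := Ioo_mem_nhds (by linarith) (by linarith)
  have hIneg : ∀ s ∈ Ioo (2 * t) (t / 2), s < 0 := fun s hs => by linarith [hs.2]
  have hw0 : ∀ s ∈ Ioo (2 * t) (t / 2), ∀ y, ‖timeDeriv v s y‖ ≤ |W₀| / a ^ 3 := by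
    intro s hs y
    have h := unif_of_scaleInvariant (g := fun s y => ‖iteratedFDeriv ℝ 0 (timeDeriv v s) y‖) ht hW₀ hs y
    rwa [norm_iteratedFDeriv_zero] at h
  have hw2 : ∀ s ∈ Ioo (2 * t) (t / 2), ∀ y, ‖iteratedFDeriv ℝ 2 (timeDeriv v s) y‖ ≤ |W₂| / a ^ 5 :=
    fun s hs y => unif_of_scaleInvariant (g := fun s y => ‖iteratedFDeriv ℝ 2 (timeDeriv v s) y‖) ht hW₂ hs y
  -- the integrands
  set F : ℝ → EuclideanSpace ℝ (Fin 3) → EuclideanSpace ℝ (Fin 3) := fun s z =>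
    lamK z • ((2 : ℝ) • v s x - v s (x + z) - v s (x - z)) with hF
  set F' : ℝ → EuclideanSpace ℝ (Fin 3) → EuclideanSpace ℝ (Fin 3) := fun s z =>
    lamK z • ((2 : ℝ) • timeDeriv v s x - timeDeriv v s (x + z) - timeDeriv v s (x - z)) with hF'
  -- integrability of `F s`, `s < 0`
  have hFint : ∀ s < (0 : ℝ), Integrable (F s) := by
    intro s hs
    have hcd : ContDiff ℝ 2 (v s) := contDiff_infty.1 (hsol.contDiff_velocity hs) 2
    have hsq : 0 < Real.sqrt (-s) := Real.sqrt_pos.2 (neg_pos.2 hs)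
    have hunif : ∀ {L : ℝ} {n : ℕ} (y : EuclideanSpace ℝ (Fin 3)),
        ‖iteratedFDeriv ℝ n (v s) y‖ ≤ L / (‖y‖ + Real.sqrt (-s)) ^ (1 + n) →
          ‖iteratedFDeriv ℝ n (v s) y‖ ≤ |L| / Real.sqrt (-s) ^ (1 + n) := by
      intro L n y h
      calc ‖iteratedFDeriv ℝ n (v s) y‖ ≤ L / (‖y‖ + Real.sqrt (-s)) ^ (1 + n) := h
        _ ≤ |L| / (‖y‖ + Real.sqrt (-s)) ^ (1 + n) := div_le_div_of_nonneg_right (le_abs_self _) (by positivity)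
        _ ≤ |L| / Real.sqrt (-s) ^ (1 + n) := div_le_div_of_nonneg_left (abs_nonneg _) (by positivity)
            (pow_le_pow_left₀ hsq.le (by linarith [norm_nonneg y]) _)
    have h0 : ∀ y, ‖v s y‖ ≤ |L₀| / Real.sqrt (-s) ^ (1 + 0) := fun y => by
      have h := hunif y (hL₀ s hs y).1
      rwa [norm_iteratedFDeriv_zero] at h
    have h2 : ∀ y, ‖iteratedFDeriv ℝ 2 (v s) y‖ ≤ |L₂| / Real.sqrt (-s) ^ (1 + 2) := fun y => hunif y (hL₂ s hs y).1
    exact integrable_fracLapHalf_integrand_of_contDiff hcd h0 h2 x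
  have hFmeas : ∀ᶠ s in 𝓝 t, AEStronglyMeasurable (F s) volume := by
    filter_upwards [hI] with s hs using (hFint s (hIneg s hs)).aestronglyMeasurable
  -- the derivative integrand at `t` is measurable
  have hwc : ∀ s < (0 : ℝ), Continuous (timeDeriv v s) := fun s hs => (contDiff_timeDeriv hsol hs 0).continuous
  have hF'meas : AEStronglyMeasurable (F' t) volume := by
    have hc : Continuous fun z : EuclideanSpace ℝ (Fin 3) =>
        (2 : ℝ) • timeDeriv v t x - timeDeriv v t (x + z) - timeDeriv v t (x - z) :=
      (continuous_const.sub ((hwc t ht).comp (continuous_const.add continuous_id))).sub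
        ((hwc t ht).comp (continuous_const.sub continuous_id))
    exact measurable_lamK.aestronglyMeasurable.smul hc.aestronglyMeasurable
  -- domination of `F'` on the neighbourhood
  have hdom : ∀ᵐ z ∂(volume : Measure (EuclideanSpace ℝ (Fin 3))), ∀ s ∈ Ioo (2 * t) (t / 2),
      ‖F' s z‖ ≤ derivDom (|W₀| / a ^ 3) (|W₂| / a ^ 5) z :=
    ae_of_all _ fun z s hs =>
      norm_integrand_le_derivDom (contDiff_timeDeriv hsol (hIneg s hs) 2) (hw0 s hs) (hw2 s hs) x z
  -- pointwise derivative
  have hderiv : ∀ᵐ z ∂(volume : Measure (EuclideanSpace ℝ (Fin 3))), ∀ s ∈ Ioo (2 * t) (t / 2),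
      HasDerivAt (fun r => F r z) (F' s z) s := by
    refine ae_of_all _ fun z s hs => ?_
    have hs0 : s < 0 := hIneg s hs
    have h1 := hasDerivAt_timeLine hsol hs0 x
    have h2 := hasDerivAt_timeLine hsol hs0 (x + z)
    have h3 := hasDerivAt_timeLine hsol hs0 (x - z)
    exact (((h1.const_smul (2 : ℝ)).sub h2).sub h3).const_smul (lamK z)
  have key := hasDerivAt_integral_of_dominated_loc_of_deriv_le hI hFmeas (hFint t ht) hF'meas hdom
    (integrable_derivDom _ _) hderiv
  exact key.2.const_smul (1 / 2 : ℝ)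

end Summit.NavierStokesRegularity.NavierStokesRegularity.Theorems.CriticalFluxDoorTimeDeriv

end
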